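import Summits.QuantumFields.YangMills.Theorems.UnitScaleTiltProp7Growth142T3ChartEL
import Summits.QuantumFields.YangMills.Theorems.UnitScaleTiltProp7FirstVariationCurrent
import HarnessLib

/-!
# Route `UnitScaleTilt`, crux K1 child «MinimiserStabilityRegPr» (stmt-QuantumFields-19200) — `EL_W` AT THE CURRENT RATE: the first variation of a general chart competitor
# at an R2-critical `W ∈ 𝔘_k(e)` is charged at the DIVERGENCE rate `e·L^{−3(K−n)}` of (2) (not the plaquette rate `e·L^{−2(K−n)}`), against its distance to the tangent
# space of Σ_k

Cell `ym3-torus`, width seat `ym-ust-19200-w4` (gen 4; the seat's LOCATED correction 2026-08-28 to `PV3ESigma`: the plaquette-rate Lipschitz bound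
`Prop7Growth142T3ChartEL.abs_lin_chart_le_of_sigmaVelocity` loses one power of `ℓ = L^{K−n}` against the slice gap; the cure is [Balaban1985Variational] (6) ∕
[Balaban1985RegularSpaces] (1.9): `Lin_W(Z) = −½Σ_b Re Tr(Z(b)·(D^*_W ∂W)(b))` (`Prop7FirstVariationCurrent.lin_eq_neg_half_sum_re_trace_mul_covDivT`) and the divergence
clause `‖(D^*_W∂W)(b)‖ < e·L^{−3(K−n)}` of the regular space (`Prop7FirstVariationCurrent.abs_lin_le_of_divSmall_T3`)).  THEOREMS ONLY (0 `def`, 0 `sorry`).  YM₃ on T³ is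
a ladder rung (R3), not the Clay problem; nothing here claims the stub, the crux, d = 4 or the mass gap.

WHAT IS PROVED (ns `…Theorems.Prop7Growth142T3ChartELCurrent`).  `lin_sub_lin_eq` (`Lin_W(Z) − Lin_W(ξ) = Lin_W(Z − ξ)`, from `Prop8Criticality.linPlaq_sub_smul` at `t = 1`);
★ `abs_lin_sub_lin_le_of_divSmall` (`DivSmall F n K e W` ⟹ `|Lin_W(Z) − Lin_W(ξ)| ≤ e·(L^{K−n})⁻³·Σ_b‖Z(b) − ξ(b)‖`);
★★ `abs_lin_chart_le_of_sigmaVelocity_current` — at an R2-critical `W ∈ (6)(e) ∩ 𝔅_k(V)`, for a chart coordinate `D` and ANY Σ_k-curve through `W` with bond velocities `ξ`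
(`Lin_W(ξ) = 0`, `Prop7Growth142T3ChartEL.lin_eq_zero_of_isCritR2_of_gaugeFibre`): `|ℓ_W(D)| ≤ e·(L^{K−n})⁻³·Σ_b‖iD(b) − ξ(b)‖`.  With the Σ_k-curvature in `ℓ¹`
of size `c₀·L^{K−n}·Σ‖D‖²` ([Balaban1985Variational] (47)–(48)) this is `c₀·e·L^{−2(K−n)}·Σ‖D‖²` — the power of the slice gap.

HONEST SCOPE.  Bookkeeping over landed letters; nothing of print asserted; `--supports stmt-QuantumFields-19200`, count-neutral.

References: T. Bałaban, CMP 102 (1985) 277–309 [Balaban1985Variational] ((2), (6) p.278, (127) p.297, (141) p.299); CMP 99 (1985) 75–102 [Balaban1985RegularSpaces] ((1.9) p.77).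
-/

set_option autoImplicit false
noncomputable section

open scoped BigOperators Matrix.Norms.L2Operator Matrix Topology
open Filter

namespace Summit.QuantumFields.YangMills.Theorems.Prop7Growth142T3ChartELCurrent

open Literature.MathematicalPhysics.QuantumFieldTheory.Balaban1983to89
open Literature.MathematicalPhysics.QuantumFieldTheory.Balaban1983to89.T3ContinuumYM3Torus
open Literature.MathematicalPhysics.QuantumFieldTheory.Balaban1983to89.T3UnitLawDensityEML (ℰp)
open Literature.MathematicalPhysics.QuantumFieldTheory.Balaban1983to89.T3ConstrainedMinimiser
open Literature.MathematicalPhysics.QuantumFieldTheory.Balaban1983to89.T3Thm1Carrier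
open Literature.MathematicalPhysics.QuantumFieldTheory.Balaban1983to89.T3PrintedRegularMinimiser
open Literature.MathematicalPhysics.QuantumFieldTheory.Balaban1983to89.T3RegularMinimiser
open Literature.MathematicalPhysics.QuantumFieldTheory.Balaban1983to89.T3Thm1CarrierNative (IsCritR2)
open Summit.QuantumFields.YangMills.Theorems.Prop8Criticality (linPlaq_sub_smul)
open Summit.QuantumFields.YangMills.Theorems.Prop7FirstVariationCurrent (abs_lin_le_of_divSmall_T3)
open Summit.QuantumFields.YangMills.Theorems.Prop7Growth142T3ChartEL (lin_eq_zero_of_isCritR2_of_gaugeFibre)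

variable {F : T3Family} {n K : ℕ} {h : n ≤ K}

/-- `Lin_W(Z) − Lin_W(ξ) = Lin_W(Z − ξ)` — `Lin_W` is real-linear in the velocity (`Prop8Criticality.linPlaq_sub_smul` at `t = 1`). [cite: Balaban1985Variational, (127) p.297] -/
theorem lin_sub_lin_eq (W : GaugeField (F.P K) 0 (Matrix.specialUnitaryGroup (Fin 2) ℂ)) (Z ξ : PBond (F.P K) 0 → Matrix (Fin 2) (Fin 2) ℂ) :
    (∑ p : Plaq (F.P K) 0, (1 / 2) * ((((((GaugeField.plaqHol W p : Matrix.specialUnitaryGroup (Fin 2) ℂ) : Matrix (Fin 2) (Fin 2) ℂ)) - 1)ᴴ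
          * ((Z ⟨p.src, p.μ⟩
              + (W ⟨p.src, p.μ⟩ : Matrix (Fin 2) (Fin 2) ℂ) * Z ⟨p.src.shift p.μ, p.ν⟩ * star (W ⟨p.src, p.μ⟩ : Matrix (Fin 2) (Fin 2) ℂ)
              - ((W ⟨p.src, p.μ⟩ * W ⟨p.src.shift p.μ, p.ν⟩ * (W ⟨p.src.shift p.ν, p.μ⟩)⁻¹ : Matrix.specialUnitaryGroup (Fin 2) ℂ) : Matrix (Fin 2) (Fin 2) ℂ)
                  * Z ⟨p.src.shift p.ν, p.μ⟩
                  * star ((W ⟨p.src, p.μ⟩ * W ⟨p.src.shift p.μ, p.ν⟩ * (W ⟨p.src.shift p.ν, p.μ⟩)⁻¹ : Matrix.specialUnitaryGroup (Fin 2) ℂ) : Matrix (Fin 2) (Fin 2) ℂ)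
              - ((GaugeField.plaqHol W p : Matrix.specialUnitaryGroup (Fin 2) ℂ) : Matrix (Fin 2) (Fin 2) ℂ) * Z ⟨p.src, p.ν⟩
                  * star ((GaugeField.plaqHol W p : Matrix.specialUnitaryGroup (Fin 2) ℂ) : Matrix (Fin 2) (Fin 2) ℂ))
            * ((GaugeField.plaqHol W p : Matrix.specialUnitaryGroup (Fin 2) ℂ) : Matrix (Fin 2) (Fin 2) ℂ))).trace).re)
      - (∑ p : Plaq (F.P K) 0, (1 / 2) * ((((((GaugeField.plaqHol W p : Matrix.specialUnitaryGroup (Fin 2) ℂ) : Matrix (Fin 2) (Fin 2) ℂ)) - 1)ᴴ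
          * ((ξ ⟨p.src, p.μ⟩
              + (W ⟨p.src, p.μ⟩ : Matrix (Fin 2) (Fin 2) ℂ) * ξ ⟨p.src.shift p.μ, p.ν⟩ * star (W ⟨p.src, p.μ⟩ : Matrix (Fin 2) (Fin 2) ℂ)
              - ((W ⟨p.src, p.μ⟩ * W ⟨p.src.shift p.μ, p.ν⟩ * (W ⟨p.src.shift p.ν, p.μ⟩)⁻¹ : Matrix.specialUnitaryGroup (Fin 2) ℂ) : Matrix (Fin 2) (Fin 2) ℂ)
                  * ξ ⟨p.src.shift p.ν, p.μ⟩
                  * star ((W ⟨p.src, p.μ⟩ * W ⟨p.src.shift p.μ, p.ν⟩ * (W ⟨p.src.shift p.ν, p.μ⟩)⁻¹ : Matrix.specialUnitaryGroup (Fin 2) ℂ) : Matrix (Fin 2) (Fin 2) ℂ)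
              - ((GaugeField.plaqHol W p : Matrix.specialUnitaryGroup (Fin 2) ℂ) : Matrix (Fin 2) (Fin 2) ℂ) * ξ ⟨p.src, p.ν⟩
                  * star ((GaugeField.plaqHol W p : Matrix.specialUnitaryGroup (Fin 2) ℂ) : Matrix (Fin 2) (Fin 2) ℂ))
            * ((GaugeField.plaqHol W p : Matrix.specialUnitaryGroup (Fin 2) ℂ) : Matrix (Fin 2) (Fin 2) ℂ))).trace).re)
      = ∑ p : Plaq (F.P K) 0, (1 / 2) * ((((((GaugeField.plaqHol W p : Matrix.specialUnitaryGroup (Fin 2) ℂ) : Matrix (Fin 2) (Fin 2) ℂ)) - 1)ᴴ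
          * (((Z ⟨p.src, p.μ⟩ - ξ ⟨p.src, p.μ⟩)
              + (W ⟨p.src, p.μ⟩ : Matrix (Fin 2) (Fin 2) ℂ) * (Z ⟨p.src.shift p.μ, p.ν⟩ - ξ ⟨p.src.shift p.μ, p.ν⟩) * star (W ⟨p.src, p.μ⟩ : Matrix (Fin 2) (Fin 2) ℂ)
              - ((W ⟨p.src, p.μ⟩ * W ⟨p.src.shift p.μ, p.ν⟩ * (W ⟨p.src.shift p.ν, p.μ⟩)⁻¹ : Matrix.specialUnitaryGroup (Fin 2) ℂ) : Matrix (Fin 2) (Fin 2) ℂ)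
                  * (Z ⟨p.src.shift p.ν, p.μ⟩ - ξ ⟨p.src.shift p.ν, p.μ⟩)
                  * star ((W ⟨p.src, p.μ⟩ * W ⟨p.src.shift p.μ, p.ν⟩ * (W ⟨p.src.shift p.ν, p.μ⟩)⁻¹ : Matrix.specialUnitaryGroup (Fin 2) ℂ) : Matrix (Fin 2) (Fin 2) ℂ)
              - ((GaugeField.plaqHol W p : Matrix.specialUnitaryGroup (Fin 2) ℂ) : Matrix (Fin 2) (Fin 2) ℂ) * (Z ⟨p.src, p.ν⟩ - ξ ⟨p.src, p.ν⟩)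
                  * star ((GaugeField.plaqHol W p : Matrix.specialUnitaryGroup (Fin 2) ℂ) : Matrix (Fin 2) (Fin 2) ℂ))
            * ((GaugeField.plaqHol W p : Matrix.specialUnitaryGroup (Fin 2) ℂ) : Matrix (Fin 2) (Fin 2) ℂ))).trace).re := by
  rw [← Finset.sum_sub_distrib]
  refine Finset.sum_congr rfl fun p _ => ?_
  have hp := linPlaq_sub_smul W Z ξ 1 p
  simp only [Complex.ofReal_one, one_smul, one_mul] at hp
  exact hp

/-- ★ **THE FIRST VARIATION AT THE CURRENT RATE**: on print's regular space (divergence clause `‖(D^*_W∂W)(b)‖ < e·L^{−3(K−n)}`),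
`|Lin_W(Z) − Lin_W(ξ)| ≤ e·(L^{K−n})⁻³·Σ_b‖Z(b) − ξ(b)‖`. [cite: Balaban1985Variational, (2), (6) p.278; Balaban1985RegularSpaces, (1.9) p.77] -/
theorem abs_lin_sub_lin_le_of_divSmall {e : ℝ} (W : GaugeField (F.P K) 0 (Matrix.specialUnitaryGroup (Fin 2) ℂ)) (hW : DivSmall F n K e W)
    (Z ξ : PBond (F.P K) 0 → Matrix (Fin 2) (Fin 2) ℂ) :
    |(∑ p : Plaq (F.P K) 0, (1 / 2) * ((((((GaugeField.plaqHol W p : Matrix.specialUnitaryGroup (Fin 2) ℂ) : Matrix (Fin 2) (Fin 2) ℂ)) - 1)ᴴ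
          * ((Z ⟨p.src, p.μ⟩
              + (W ⟨p.src, p.μ⟩ : Matrix (Fin 2) (Fin 2) ℂ) * Z ⟨p.src.shift p.μ, p.ν⟩ * star (W ⟨p.src, p.μ⟩ : Matrix (Fin 2) (Fin 2) ℂ)
              - ((W ⟨p.src, p.μ⟩ * W ⟨p.src.shift p.μ, p.ν⟩ * (W ⟨p.src.shift p.ν, p.μ⟩)⁻¹ : Matrix.specialUnitaryGroup (Fin 2) ℂ) : Matrix (Fin 2) (Fin 2) ℂ)
                  * Z ⟨p.src.shift p.ν, p.μ⟩
                  * star ((W ⟨p.src, p.μ⟩ * W ⟨p.src.shift p.μ, p.ν⟩ * (W ⟨p.src.shift p.ν, p.μ⟩)⁻¹ : Matrix.specialUnitaryGroup (Fin 2) ℂ) : Matrix (Fin 2) (Fin 2) ℂ)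
              - ((GaugeField.plaqHol W p : Matrix.specialUnitaryGroup (Fin 2) ℂ) : Matrix (Fin 2) (Fin 2) ℂ) * Z ⟨p.src, p.ν⟩
                  * star ((GaugeField.plaqHol W p : Matrix.specialUnitaryGroup (Fin 2) ℂ) : Matrix (Fin 2) (Fin 2) ℂ))
            * ((GaugeField.plaqHol W p : Matrix.specialUnitaryGroup (Fin 2) ℂ) : Matrix (Fin 2) (Fin 2) ℂ))).trace).re)
      - (∑ p : Plaq (F.P K) 0, (1 / 2) * ((((((GaugeField.plaqHol W p : Matrix.specialUnitaryGroup (Fin 2) ℂ) : Matrix (Fin 2) (Fin 2) ℂ)) - 1)ᴴ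
          * ((ξ ⟨p.src, p.μ⟩
              + (W ⟨p.src, p.μ⟩ : Matrix (Fin 2) (Fin 2) ℂ) * ξ ⟨p.src.shift p.μ, p.ν⟩ * star (W ⟨p.src, p.μ⟩ : Matrix (Fin 2) (Fin 2) ℂ)
              - ((W ⟨p.src, p.μ⟩ * W ⟨p.src.shift p.μ, p.ν⟩ * (W ⟨p.src.shift p.ν, p.μ⟩)⁻¹ : Matrix.specialUnitaryGroup (Fin 2) ℂ) : Matrix (Fin 2) (Fin 2) ℂ)
                  * ξ ⟨p.src.shift p.ν, p.μ⟩
                  * star ((W ⟨p.src, p.μ⟩ * W ⟨p.src.shift p.μ, p.ν⟩ * (W ⟨p.src.shift p.ν, p.μ⟩)⁻¹ : Matrix.specialUnitaryGroup (Fin 2) ℂ) : Matrix (Fin 2) (Fin 2) ℂ)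
              - ((GaugeField.plaqHol W p : Matrix.specialUnitaryGroup (Fin 2) ℂ) : Matrix (Fin 2) (Fin 2) ℂ) * ξ ⟨p.src, p.ν⟩
                  * star ((GaugeField.plaqHol W p : Matrix.specialUnitaryGroup (Fin 2) ℂ) : Matrix (Fin 2) (Fin 2) ℂ))
            * ((GaugeField.plaqHol W p : Matrix.specialUnitaryGroup (Fin 2) ℂ) : Matrix (Fin 2) (Fin 2) ℂ))).trace).re)|
      ≤ e * (((F.L : ℝ) ^ (K - n)) ^ 3)⁻¹ * ∑ b : PBond (F.P K) 0, ‖Z b - ξ b‖ := by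
  rw [lin_sub_lin_eq W Z ξ]
  exact abs_lin_le_of_divSmall_T3 F n K W hW (fun b => Z b - ξ b)

/-- ★★ **`EL_W` FOR A GENERAL CHART COMPETITOR AT THE CURRENT RATE**: at an R2-critical `W ∈ (6)(e) ∩ 𝔅_k(V)`, for a Hermitian-traceless `D` and any Σ_k-curve `γ`
through `W` (continuous at `0`, gauge copies in `𝔅_k(V)` near `0`, bond velocities `ξ`): `|ℓ_W(D)| ≤ e·(L^{K−n})⁻³·Σ_b‖iD(b) − ξ(b)‖` — one power of `L^{K−n}` better than
the plaquette-rate bound `Prop7Growth142T3ChartEL.abs_lin_chart_le_of_sigmaVelocity`, the power the slice gap requires. [cite: Balaban1985Variational, (141) p.299, (6) p.278, (47)-(48) pp.285-286] -/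
theorem abs_lin_chart_le_of_sigmaVelocity_current {V : GaugeField (F.P n) 0 (Matrix.specialUnitaryGroup (Fin 2) ℂ)} {W : GaugeField (F.P K) 0 (Matrix.specialUnitaryGroup (Fin 2) ℂ)}
    (hW : IsCritR2 F n K h V W) {e : ℝ} (hWe : W ∈ regFibrePr F n K h e V)
    (D : PBond (F.P K) 0 → Matrix (Fin 2) (Fin 2) ℂ)
    (γ : ℝ → GaugeField (F.P K) 0 (Matrix.specialUnitaryGroup (Fin 2) ℂ)) (hγ0 : γ 0 = W) (hγc : ContinuousAt γ 0)
    (hγfib : ∀ᶠ t in 𝓝 (0 : ℝ), ∃ u : GaugeTransf (F.P K) 0 (Matrix.specialUnitaryGroup (Fin 2) ℂ), GaugeField.gaugeAct u (γ t) ∈ fibre F ℰp n K h V)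
    (ξ : PBond (F.P K) 0 → Matrix (Fin 2) (Fin 2) ℂ)
    (hγξ : ∀ b : PBond (F.P K) 0, HasDerivAt (fun t : ℝ => (γ t b : Matrix (Fin 2) (Fin 2) ℂ) * star (W b : Matrix (Fin 2) (Fin 2) ℂ)) (ξ b) 0) :
    |∑ p : Plaq (F.P K) 0, (1 / 2) * (((((GaugeField.plaqHol W p : Matrix.specialUnitaryGroup (Fin 2) ℂ) : Matrix (Fin 2) (Fin 2) ℂ) - 1)ᴴ * (((Complex.I • D ⟨p.src, p.μ⟩) + ((W ⟨p.src, p.μ⟩ : Matrix (Fin 2) (Fin 2) ℂ) * (Complex.I • D ⟨p.src.shift p.μ, p.ν⟩) * star (W ⟨p.src, p.μ⟩ : Matrix (Fin 2) (Fin 2) ℂ))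
            - (((W ⟨p.src, p.μ⟩ * W ⟨p.src.shift p.μ, p.ν⟩ * (W ⟨p.src.shift p.ν, p.μ⟩)⁻¹ : Matrix.specialUnitaryGroup (Fin 2) ℂ) : Matrix (Fin 2) (Fin 2) ℂ) * (Complex.I • D ⟨p.src.shift p.ν, p.μ⟩) * star ((W ⟨p.src, p.μ⟩ * W ⟨p.src.shift p.μ, p.ν⟩ * (W ⟨p.src.shift p.ν, p.μ⟩)⁻¹ : Matrix.specialUnitaryGroup (Fin 2) ℂ) : Matrix (Fin 2) (Fin 2) ℂ))
            - (((GaugeField.plaqHol W p : Matrix.specialUnitaryGroup (Fin 2) ℂ) : Matrix (Fin 2) (Fin 2) ℂ) * (Complex.I • D ⟨p.src, p.ν⟩) * star ((GaugeField.plaqHol W p : Matrix.specialUnitaryGroup (Fin 2) ℂ) : Matrix (Fin 2) (Fin 2) ℂ))) * ((GaugeField.plaqHol W p : Matrix.specialUnitaryGroup (Fin 2) ℂ) : Matrix (Fin 2) (Fin 2) ℂ))).trace).re|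
      ≤ e * (((F.L : ℝ) ^ (K - n)) ^ 3)⁻¹ * ∑ b : PBond (F.P K) 0, ‖Complex.I • D b - ξ b‖ := by
  have h0 := lin_eq_zero_of_isCritR2_of_gaugeFibre hW γ hγ0 hγc hγfib ξ hγξ
  have hreg : RegPr F n K e W := ((mem_regFibrePr_iff F).mp hWe).2
  have h := abs_lin_sub_lin_le_of_divSmall W hreg.2 (fun b => Complex.I • D b) ξ
  simpa only [h0, sub_zero] using h

end Summit.QuantumFields.YangMills.Theorems.Prop7Growth142T3ChartELCurrent

end
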